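import Literature.MathematicalPhysics.QuantumLattice.FreeFermionSlaterModes
import Literature.MathematicalPhysics.QuantumLattice.HubbardOneParticleCost
import Literature.MathematicalPhysics.QuantumLattice.FalicovKimballChessboardBound
import Mathlib.Combinatorics.SimpleGraph.AdjMatrix
import HarnessLib

/-!
# The Langer–Mattis / Kennedy–Lieb lower bound for the Hubbard ground-state energy

Topic `MathematicalPhysics/QuantumLattice`, family `hubbard`. For the Hubbard Hamiltonian
`H = hamiltonian G t U = -t Σ_{⟨xy⟩,σ} c†_{xσ}c_{yσ} + U Σ_x n_{x↑}n_{x↓}` of the tree (`HubbardWave0`)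
on a finite BIPARTITE graph `G` (sites `Λ`, a two-colouring `p : Λ → Bool` with `x ∼ y → p x ≠ p y`),
any real `t`, `U` and every particle number `N ≤ 2|Λ|`, we PROVE

  `E_G(N) = groundEnergyAt G t U N ≥ (U/2) N - (U/4) |Λ| - Σ_i √(λ_i² + U²/16)`,

where `λ_i` are the eigenvalues of the hopping matrix `t·A_G` (`hopMatrix G t = t • adjMatrix`).
At half filling `N = |Λ|` this is Langer–Mattis' `E₀ ≥ E_A(U/2, 1) = U/4 - |Λ|⁻¹ Σ_k √(ε_k² + U²/16)`
per site [LangerMattis1971, eqs. (3)–(5)], the best rigorous lower bound in print for the half-filled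
square lattice.

## The argument (Langer–Mattis 1971, made rigorous by Kennedy–Lieb 1986)

* `H = H_↑ + H_↓` with `H_σ = -t T_σ + (U/2) Σ_x n_{x↑}n_{x↓}` (`speciesHamiltonian`;
  `hamiltonian_eq_add_speciesHamiltonian`) and `E₀(H) ≥ inf H_↑ + inf H_↓` [LangerMattis1971, eq. (4)].
* In `H_σ` the other species `τ ≠ σ` is immobile: `H_σ` commutes with the projections `P^τ_w`
  (`configProj τ w`) onto the configurations whose `τ`-electrons occupy exactly `w ⊆ Λ`, and on the
  range of `P^τ_w` it acts as the second quantisation `dΓ_σ(A_w)` (`dGammaSpin`) of the one-body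
  matrix `A_w = -t A_G + (U/2) 1_w` (`lmOneBody`; `speciesHamiltonian_mul_configProj`)
  [LangerMattis1971, eq. (5)]: a Falicov–Kimball problem `A_w = h(s_w) + (U/4)·1`,
  `h(s) = -tA_G + (U/4) diag(s)`, `s_w = 2·1_w - 1 ∈ {±1}` (`lmOneBody_eq_fkOneBody`).
* One-body (Langer–Mattis) bound on Fock space: `Re ⟨φ, dΓ_σ(h) φ⟩ ≥ (Σ_i min(λ_i(h), 0)) ‖φ‖²`
  (`sum_min_eigenvalues_mul_normSq_le`), from the spectral expansion
  `Re ⟨φ, dΓ_σ(h) φ⟩ = Σ_k λ_k ‖c(v_k ⊗ e_σ) φ‖²` and the Pauli principle `‖c(f)φ‖² ≤ ‖φ‖²`.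
* Kennedy–Lieb [KennedyLieb1986, Thm 2.1; LiebLoss1993, §8 Lemma 8.1 / Thm 8.2], in the tree as
  `FalicovKimball.kennedyLieb_sum_eigenvalues_ge`: for bipartite `K` every partial sum of eigenvalues
  of `h(s)` is `≥ ½ (u Σ_x s_x - Σ_i √(λ_i(K)² + u²))` — the configuration minimum is the chessboard,
  which is what Langer–Mattis took for granted ("spins-down immobilized at one of the
  antiferromagnetic sublattices").
* Summing over `w` with `Σ_w |w| ‖P^τ_w ψ‖² = ⟨ψ, N_τ ψ⟩` gives the operator inequality
  `H_σ ≥ (U/4)(N_σ + N_τ) - ½((U/4)|Λ| + Σ_i √(λ_i² + U²/16))` (`re_rayleigh_speciesHamiltonian_ge`),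
  hence `H ≥ (U/2) N̂ - (U/4)|Λ| - Σ_i √(λ_i² + U²/16)` (`re_rayleigh_hamiltonian_ge`) and the bound on
  `groundEnergyAt` (`groundEnergyAt_ge`, `groundEnergyAt_halfFilling_ge`).

No sign assumption on `t` or `U` is needed (for `U < 0` the bound is valid but not the one
Langer–Mattis would use). Everything is proved; the definitions (`occ`, `configProj`, `hopOp`,
`speciesHamiltonian`, `dGammaSpin`, `hopMatrix`, `pmSign`, `lmOneBody`, `langerMattisSum`) are
concrete bookkeeping objects; no named facts.

## References

* W. D. Langer, D. C. Mattis, *Ground state energy of Hubbard model*, Phys. Lett. 36A (1971) 139–140,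
  eqs. (3)–(5) (read in the reprint volume A. Montorsi (ed.), *The Hubbard Model*, pp. 109–110).
  [LangerMattis1971]
* T. Kennedy, E. H. Lieb, *An itinerant electron model with crystalline or magnetic long range
  order*, Physica A 138 (1986) 320–358, Lemma 2.2, Theorem 2.1. [KennedyLieb1986]
* E. H. Lieb, M. Loss, *Fluxes, Laplacians, and Kasteleyn's theorem*, Duke Math. J. 71 (1993)
  337–363, §8, Lemma 8.1, Theorem 8.2 and its proof (`E₀^{(N)} ≥ -½Tr|h| + ½Tr h + UN`).
  [LiebLoss1993]

## Mathlib / tree search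

Tree (REUSED): `hamiltonian`, `numberOp`, `totalNumber`, `groundEnergyAt`,
`ThermodynamicLimit.exists_unit_groundState`, `LiebThm1.numberOp_eq_diagonal`,
`LiebThm1.creation_mul_annihilation_apply`, `numberOp_mul_numberOp_eq_diagonal`,
`totalNumberOp_eq_diagonal`, `totalNumberOp_eq_totalNumber`, `sum_numberOp_mulVec_apply`,
`HubbardBandBottom.apply_eq_sum_eigenmodes/star_dotProduct_numberMode_mulVec/normSq_annihilate_mulVec_le`,
`spinMode_complete/unit`, `create_spinMode_eq_sum`, `annihilate_spinMode_eq_sum`,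
`RayleighBound.normSq/star_dotProduct_self_eq_normSq`,
`FalicovKimball.fkOneBody/kennedyLieb_sum_eigenvalues_ge`. Mathlib: `Matrix.IsHermitian.eigenvectorUnitary`,
`mulVec_eigenvectorBasis`, `SimpleGraph.adjMatrix`, `Matrix.mul_diagonal/diagonal_mul`.
-/

noncomputable section

namespace Literature.MathematicalPhysics.QuantumLattice

open Matrix Finset Literature.MathematicalPhysics.QuantumLattice.RayleighBound
  Literature.MathematicalPhysics.QuantumLattice.HubbardBandBottom
open scoped ComplexOrder ComplexConjugate

namespace LangerMattis

variable {Λ : Type*} [LinearOrder Λ] [Fintype Λ]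

/-! ### Frozen-species configurations and the projections `P^τ_w` -/

/-- The set of sites carrying a `τ`-electron in the occupation configuration `s`
(`= upPart s` / `downPart s` for `τ = 0 / 1`). Langer–Mattis' immobilised species.
[cite: LangerMattis1971, eq. (5)] -/
def occ (τ : Fin 2) (s : Finset (Orb Λ)) : Finset Λ := univ.filter fun x => orb x τ ∈ s

/-- Membership in `occ`. [folklore] -/
theorem mem_occ {τ : Fin 2} {s : Finset (Orb Λ)} {x : Λ} :
    x ∈ occ τ s ↔ orb x τ ∈ s := by
  simp [occ]

/-- The projection `P^τ_w` onto the configurations whose `τ`-electrons occupy exactly the sites of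
`w` (a `0/1` diagonal matrix in the occupation basis). [cite: LangerMattis1971, eq. (5)] -/
def configProj (τ : Fin 2) (w : Finset Λ) : Matrix (Finset (Orb Λ)) (Finset (Orb Λ)) ℂ :=
  diagonal fun s => if occ τ s = w then 1 else 0

/-- `P^τ_w` is idempotent. [folklore] -/
theorem configProj_mul_self (τ : Fin 2) (w : Finset Λ) :
    configProj τ w * configProj τ w = configProj τ w := by
  rw [configProj, diagonal_mul_diagonal]
  congr 1
  funext s
  by_cases h : occ τ s = w <;> simp [h]

/-- `P^τ_w` is self-adjoint. [folklore] -/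
theorem configProj_conjTranspose (τ : Fin 2) (w : Finset Λ) :
    (configProj τ w)ᴴ = configProj τ w := by
  rw [configProj, diagonal_conjTranspose]
  congr 1
  funext s
  by_cases h : occ τ s = w <;> simp [h]

/-- The `P^τ_w` resolve the identity: `Σ_w P^τ_w = 1`. [folklore] -/
theorem sum_configProj (τ : Fin 2) :
    ∑ w : Finset Λ, configProj τ w = (1 : Matrix (Finset (Orb Λ)) (Finset (Orb Λ)) ℂ) := by
  ext s u
  rw [Matrix.sum_apply]
  simp only [configProj, diagonal_apply, one_apply]
  by_cases hsu : s = u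
  · simp only [hsu, if_true, Finset.sum_ite_eq, Finset.mem_univ]
  · simp [hsu]

/-- A matrix whose nonzero entries join configurations with the same `τ`-occupation commutes with
every `P^τ_w`. [folklore] -/
theorem commute_configProj_of_occ_eq (τ : Fin 2) {M : Matrix (Finset (Orb Λ)) (Finset (Orb Λ)) ℂ}
    (hM : ∀ s u, M s u ≠ 0 → occ τ s = occ τ u) (w : Finset Λ) :
    Commute M (configProj τ w) := by
  show M * configProj τ w = configProj τ w * M
  ext s u
  rw [configProj, mul_diagonal, diagonal_mul]
  by_cases h : M s u = 0
  · simp [h]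
  · rw [hM s u h, mul_comm]

/-- Diagonal matrices commute with every `P^τ_w`. [folklore] -/
theorem commute_configProj_diagonal (τ : Fin 2) (d : Finset (Orb Λ) → ℂ) (w : Finset Λ) :
    Commute (diagonal d) (configProj τ w) :=
  commute_configProj_of_occ_eq τ (fun s u h => by
    by_contra hsu
    exact h (diagonal_apply_ne d fun h' => hsu (h' ▸ rfl))) w

/-- A hopping term `c†_{xσ} c_{yσ}` of species `σ ≠ τ` does not move the `τ`-electrons.
[cite: LangerMattis1971, eq. (5)] -/
theorem occ_eq_of_hop_apply_ne_zero {σ τ : Fin 2} (hστ : σ ≠ τ) (x y : Λ)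
    {s u : Finset (Orb Λ)} (h : (creation (orb x σ) * annihilation (orb y σ)) s u ≠ 0) :
    occ τ s = occ τ u := by
  rw [LiebThm1.creation_mul_annihilation_apply] at h
  by_cases hc : orb x σ ∈ s ∧ orb y σ ∉ s.erase (orb x σ) ∧ u = insert (orb y σ) (s.erase (orb x σ))
  · obtain ⟨-, -, rfl⟩ := hc
    ext z
    simp only [mem_occ, Finset.mem_insert, Finset.mem_erase]
    constructor
    · intro hz
      exact Or.inr ⟨fun h' => hστ (orb_inj.1 h').2.symm, hz⟩
    · rintro (h' | ⟨-, h'⟩)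
      · exact absurd (orb_inj.1 h').2.symm hστ
      · exact h'
  · exact absurd (if_neg hc) h

/-- Hopping terms of species `σ ≠ τ` commute with every `P^τ_w`. [cite: LangerMattis1971, eq. (5)] -/
theorem commute_hop_configProj {σ τ : Fin 2} (hστ : σ ≠ τ) (x y : Λ) (w : Finset Λ) :
    Commute (creation (orb x σ) * annihilation (orb y σ)) (configProj τ w) :=
  commute_configProj_of_occ_eq τ (fun _ _ h => occ_eq_of_hop_apply_ne_zero hστ x y h) w

/-- **Block decomposition of a quadratic form along the `P^τ_w`.** If `M` commutes with every
`P^τ_w` then `⟨ψ, M ψ⟩ = Σ_w ⟨P^τ_w ψ, M P^τ_w ψ⟩`. [folklore] -/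
theorem rayleigh_eq_sum_configProj (τ : Fin 2) {M : Matrix (Finset (Orb Λ)) (Finset (Orb Λ)) ℂ}
    (hM : ∀ w, Commute M (configProj τ w)) (ψ : Fock (Orb Λ)) :
    star ψ ⬝ᵥ (M *ᵥ ψ) =
      ∑ w : Finset Λ, star (configProj τ w *ᵥ ψ) ⬝ᵥ (M *ᵥ (configProj τ w *ᵥ ψ)) := by
  have key : ∀ w, star (configProj τ w *ᵥ ψ) ⬝ᵥ (M *ᵥ (configProj τ w *ᵥ ψ)) =
      star ψ ⬝ᵥ ((M * configProj τ w) *ᵥ ψ) := by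
    intro w
    rw [mulVec_mulVec, star_mulVec, configProj_conjTranspose, ← dotProduct_mulVec, mulVec_mulVec,
      ← mul_assoc, ← (hM w).eq, mul_assoc, configProj_mul_self]
  simp_rw [key]
  rw [← dotProduct_sum, ← Matrix.sum_mulVec, ← Finset.mul_sum, sum_configProj, mul_one]

/-- In particular `Σ_w ‖P^τ_w ψ‖² = ‖ψ‖²`. [folklore] -/
theorem sum_normSq_configProj_mulVec (τ : Fin 2) (ψ : Fock (Orb Λ)) :
    ∑ w : Finset Λ, normSq (configProj τ w *ᵥ ψ) = normSq ψ := by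
  apply Complex.ofReal_injective
  rw [Complex.ofReal_sum]
  simp_rw [← star_dotProduct_self_eq_normSq]
  have h := rayleigh_eq_sum_configProj τ (M := 1) (fun w => Commute.one_left _) ψ
  simp only [one_mulVec] at h
  exact h.symm

/-! ### The species Hamiltonians `H_σ` and the splitting `H = H_↑ + H_↓` -/

variable (G : SimpleGraph Λ) [DecidableRel G.Adj]

/-- The hopping operator `T_σ = Σ_{x ∼ y} c†_{xσ} c_{yσ}` of one spin species on `G` (both orderings
of each edge, hence Hermitian). [cite: LangerMattis1971, eq. (5)] -/
def hopOp (σ : Fin 2) : Matrix (Finset (Orb Λ)) (Finset (Orb Λ)) ℂ :=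
  ∑ x : Λ, ∑ y : Λ, if G.Adj x y then creation (orb x σ) * annihilation (orb y σ) else 0

/-- Langer–Mattis' species Hamiltonian `H_σ = -t T_σ + (U/2) Σ_x n_{x↑} n_{x↓}` (their eq. (5)
without the chemical-potential bookkeeping): the kinetic energy of species `σ` plus half the
repulsion. [cite: LangerMattis1971, eq. (5)] -/
def speciesHamiltonian (t U : ℝ) (σ : Fin 2) : Matrix (Finset (Orb Λ)) (Finset (Orb Λ)) ℂ :=
  -(t : ℂ) • hopOp G σ + ((U / 2 : ℝ) : ℂ) • ∑ x : Λ, numberOp x 0 * numberOp x 1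

/-- **`H = H_↑ + H_↓`.** [cite: LangerMattis1971, eqs. (4)–(5)] -/
theorem hamiltonian_eq_add_speciesHamiltonian (t U : ℝ) :
    hamiltonian G t U = speciesHamiltonian G t U 0 + speciesHamiltonian G t U 1 := by
  have h1 : (∑ x : Λ, ∑ y : Λ, ∑ σ : Fin 2,
      (if G.Adj x y then creation (orb x σ) * annihilation (orb y σ) else
        (0 : Matrix (Finset (Orb Λ)) (Finset (Orb Λ)) ℂ))) =
      ∑ σ : Fin 2, ∑ x : Λ, ∑ y : Λ,
        (if G.Adj x y then creation (orb x σ) * annihilation (orb y σ) else 0) := by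
    have hx : ∀ x : Λ, (∑ y : Λ, ∑ σ : Fin 2,
        (if G.Adj x y then creation (orb x σ) * annihilation (orb y σ) else
          (0 : Matrix (Finset (Orb Λ)) (Finset (Orb Λ)) ℂ))) =
        ∑ σ : Fin 2, ∑ y : Λ,
          (if G.Adj x y then creation (orb x σ) * annihilation (orb y σ) else 0) :=
      fun x => Finset.sum_comm
    rw [Finset.sum_congr rfl (fun x _ => hx x), Finset.sum_comm]
  have h2 : ((U / 2 : ℝ) : ℂ) • (∑ x : Λ, numberOp x 0 * numberOp x 1 :
      Matrix (Finset (Orb Λ)) (Finset (Orb Λ)) ℂ) +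
      ((U / 2 : ℝ) : ℂ) • (∑ x : Λ, numberOp x 0 * numberOp x 1) =
      (U : ℂ) • ∑ x : Λ, numberOp x 0 * numberOp x 1 := by
    rw [← add_smul]
    congr 1
    push_cast
    ring
  rw [hamiltonian, h1, Fin.sum_univ_two, speciesHamiltonian, speciesHamiltonian, hopOp, hopOp, ← h2,
    smul_add]
  abel

/-- `H_σ` commutes with every `P^τ_w`, `τ ≠ σ`: the other species is static.
[cite: LangerMattis1971, eq. (5)] -/
theorem commute_speciesHamiltonian_configProj (t U : ℝ) {σ τ : Fin 2} (hστ : σ ≠ τ) (w : Finset Λ) :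
    Commute (speciesHamiltonian G t U σ) (configProj τ w) := by
  unfold speciesHamiltonian hopOp
  refine Commute.add_left (Commute.smul_left ?_ _) (Commute.smul_left ?_ _)
  · refine Commute.sum_left _ _ _ fun x _ => Commute.sum_left _ _ _ fun y _ => ?_
    by_cases hxy : G.Adj x y
    · rw [if_pos hxy]; exact commute_hop_configProj hστ x y w
    · rw [if_neg hxy]; exact Commute.zero_left _
  · refine Commute.sum_left _ _ _ fun x _ => ?_
    rw [numberOp_mul_numberOp_eq_diagonal]
    exact commute_configProj_diagonal τ _ w

/-! ### The one-species second quantisation `dΓ_σ` and the Langer–Mattis one-body matrix -/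

/-- The second quantisation of a site matrix in ONE spin species,
`dΓ_σ(A) = Σ_{x,y} A_{xy} c†_{xσ} c_{yσ}`. [cite: LiebLoss1993, §8 eq. (8.1)] -/
def dGammaSpin (σ : Fin 2) (A : Matrix Λ Λ ℂ) : Matrix (Finset (Orb Λ)) (Finset (Orb Λ)) ℂ :=
  ∑ x : Λ, ∑ y : Λ, A x y • (creation (orb x σ) * annihilation (orb y σ))

/-- `dΓ_σ` is additive. [folklore] -/
theorem dGammaSpin_add (σ : Fin 2) (A B : Matrix Λ Λ ℂ) :
    dGammaSpin σ (A + B) = dGammaSpin σ A + dGammaSpin σ B := by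
  simp only [dGammaSpin, Matrix.add_apply, add_smul, Finset.sum_add_distrib]

/-- `dΓ_σ` is homogeneous. [folklore] -/
theorem dGammaSpin_smul (σ : Fin 2) (c : ℂ) (A : Matrix Λ Λ ℂ) :
    dGammaSpin σ (c • A) = c • dGammaSpin σ A := by
  simp only [dGammaSpin, Matrix.smul_apply, smul_eq_mul, Finset.smul_sum, smul_smul]

/-- `dΓ_σ(1) = N_σ = Σ_x n_{xσ}`. [folklore] -/
theorem dGammaSpin_one (σ : Fin 2) :
    dGammaSpin σ (1 : Matrix Λ Λ ℂ) = ∑ x : Λ, numberOp x σ := by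
  simp only [dGammaSpin, Matrix.one_apply, ite_smul, one_smul, zero_smul, Finset.sum_ite_eq,
    Finset.mem_univ, if_true]
  rfl

/-- The hopping matrix `K = t · A_G` of the graph (`K_{xy} = t [x ∼ y]`), as a complex matrix.
[cite: LangerMattis1971, eq. (1)] -/
def hopMatrix (t : ℝ) : Matrix Λ Λ ℂ := Matrix.of fun x y => if G.Adj x y then (t : ℂ) else 0

omit [LinearOrder Λ] [Fintype Λ] in
/-- `hopMatrix G t = t • adjMatrix`. [folklore] -/
theorem hopMatrix_eq_smul_adjMatrix (t : ℝ) :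
    hopMatrix G t = (t : ℂ) • SimpleGraph.adjMatrix ℂ G := by
  ext x y
  simp [hopMatrix, SimpleGraph.adjMatrix_apply]

omit [LinearOrder Λ] [Fintype Λ] in
/-- The hopping matrix is Hermitian (real symmetric). [folklore] -/
theorem isHermitian_hopMatrix (t : ℝ) : (hopMatrix G t).IsHermitian := by
  refine Matrix.IsHermitian.ext fun x y => ?_
  simp only [hopMatrix, Matrix.of_apply, G.adj_comm x y]
  split_ifs <;> simp

omit [LinearOrder Λ] [Fintype Λ] in
/-- The hopping matrix is bipartite for any proper two-colouring of `G`. [folklore] -/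
theorem hopMatrix_bipartite (t : ℝ) (p : Λ → Bool) (hbip : ∀ x y, G.Adj x y → p x ≠ p y) :
    ∀ x y, p x = p y → hopMatrix G t x y = 0 := by
  intro x y hxy
  simp only [hopMatrix, Matrix.of_apply]
  rw [if_neg fun h => hbip x y h hxy]

/-- The `±1` configuration `s_w = 2·1_w - 1` of a set of sites. [cite: LiebLoss1993, §8 eq. (8.4)] -/
def pmSign (w : Finset Λ) : Λ → ℝ := fun x => if x ∈ w then 1 else -1

omit [Fintype Λ] in
/-- `|s_w(x)| ≤ 1`. [folklore] -/
theorem abs_pmSign_le (w : Finset Λ) (x : Λ) : |pmSign w x| ≤ 1 := by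
  unfold pmSign
  split_ifs <;> simp

/-- `Σ_x s_w(x) = 2|w| - |Λ|`. [folklore] -/
theorem sum_pmSign (w : Finset Λ) : ∑ x, pmSign w x = 2 * (w.card : ℝ) - Fintype.card Λ := by
  have h : ∀ x, pmSign w x = 2 * (if x ∈ w then (1 : ℝ) else 0) - 1 := by
    intro x
    unfold pmSign
    split_ifs <;> norm_num
  simp_rw [h]
  rw [Finset.sum_sub_distrib, ← Finset.mul_sum, Finset.sum_boole, Finset.sum_const, Finset.card_univ,
    nsmul_eq_mul, mul_one, Finset.filter_mem_eq_inter, Finset.univ_inter]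

/-- Langer–Mattis' one-body matrix of the mobile species in the frozen configuration `w`:
`A_w = -t A_G + (U/2) 1_w` (on-site energy `U/2` exactly at the occupied sites of the other
species). [cite: LangerMattis1971, eq. (5)] -/
def lmOneBody (t U : ℝ) (w : Finset Λ) : Matrix Λ Λ ℂ :=
  Matrix.of fun x y =>
    (if G.Adj x y then -(t : ℂ) else 0) + (if x = y ∧ x ∈ w then ((U / 2 : ℝ) : ℂ) else 0)

omit [Fintype Λ] in
/-- `A_w = h(s_w) + (U/4)·1` with the Falicov–Kimball operator `h(s) = -K + (U/4) diag(s)`,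
`K = t A_G`. [cite: LiebLoss1993, §8 eqs. (8.1), (8.4)] -/
theorem lmOneBody_eq_fkOneBody (t U : ℝ) (w : Finset Λ) :
    lmOneBody G t U w =
      FalicovKimball.fkOneBody (hopMatrix G t) (U / 4) (pmSign w) +
        ((U / 4 : ℝ) : ℂ) • (1 : Matrix Λ Λ ℂ) := by
  ext x y
  simp only [lmOneBody, FalicovKimball.fkOneBody, hopMatrix, pmSign, Matrix.of_apply, Matrix.add_apply,
    Matrix.neg_apply, Matrix.smul_apply, diagonal_apply, Matrix.one_apply, smul_eq_mul, mul_ite,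
    mul_one, mul_zero]
  by_cases hxy : x = y
  · subst hxy
    simp only [SimpleGraph.irrefl, if_false, true_and, if_true, neg_zero, zero_add]
    split_ifs <;> push_cast <;> ring
  · simp only [hxy, false_and, if_false, add_zero]
    split_ifs <;> simp

/-- `dΓ_σ(A_w) = -t T_σ + (U/2) Σ_{x ∈ w} n_{xσ}`. [cite: LangerMattis1971, eq. (5)] -/
theorem dGammaSpin_lmOneBody (t U : ℝ) (σ : Fin 2) (w : Finset Λ) :
    dGammaSpin σ (lmOneBody G t U w) =
      -(t : ℂ) • hopOp G σ + ((U / 2 : ℝ) : ℂ) • ∑ x ∈ w, numberOp x σ := by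
  simp only [dGammaSpin, lmOneBody, Matrix.of_apply, add_smul, Finset.sum_add_distrib]
  congr 1
  · simp only [ite_smul, zero_smul, hopOp, Finset.smul_sum, smul_ite, smul_zero, neg_smul]
  · simp only [ite_and, ite_smul, zero_smul, Finset.sum_ite_eq, Finset.mem_univ, if_true]
    rw [Finset.smul_sum, ← Finset.sum_filter, Finset.filter_mem_eq_inter, Finset.univ_inter]
    rfl

omit [LinearOrder Λ] [Fintype Λ] in
/-- For `σ ≠ τ`: `(orb x 0 ∈ s ∧ orb x 1 ∈ s) ↔ (orb x σ ∈ s ∧ orb x τ ∈ s)`. [folklore] -/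
theorem doublyOcc_iff {σ τ : Fin 2} (hστ : σ ≠ τ) (x : Λ) (s : Finset (Orb Λ)) :
    (orb x 0 ∈ s ∧ orb x 1 ∈ s) ↔ (orb x σ ∈ s ∧ orb x τ ∈ s) := by
  fin_cases σ <;> fin_cases τ
  · exact absurd rfl hστ
  · exact Iff.rfl
  · exact and_comm
  · exact absurd rfl hστ

/-- On the range of `P^τ_w` the repulsion is the one-body potential `Σ_{x ∈ w} n_{xσ}` of the
mobile species: `(Σ_x n_{x↑}n_{x↓}) P^τ_w = (Σ_{x∈w} n_{xσ}) P^τ_w`. [cite: LangerMattis1971, eq. (5)] -/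
theorem interaction_mul_configProj {σ τ : Fin 2} (hστ : σ ≠ τ) (w : Finset Λ) :
    (∑ x : Λ, numberOp x 0 * numberOp x 1) * configProj τ w =
      (∑ x ∈ w, numberOp x σ) * configProj τ w := by
  ext s u
  rw [configProj, mul_diagonal, mul_diagonal, Matrix.sum_apply, Matrix.sum_apply]
  simp only [numberOp_mul_numberOp_eq_diagonal]
  simp only [LiebThm1.numberOp_eq_diagonal]
  by_cases hsu : s = u
  · subst hsu
    by_cases hw : occ τ s = w
    · rw [if_pos hw, mul_one, mul_one, ← hw, occ, Finset.sum_filter]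
      simp only [diagonal_apply_eq]
      refine Finset.sum_congr rfl fun x _ => ?_
      by_cases h1 : orb x τ ∈ s <;> by_cases h2 : orb x σ ∈ s <;>
        simp [doublyOcc_iff hστ x s, h1, h2]
    · rw [if_neg hw, mul_zero, mul_zero]
  · simp only [diagonal_apply_ne _ hsu, Finset.sum_const_zero, zero_mul]

/-- **On the range of `P^τ_w`, `H_σ` is the free problem `dΓ_σ(A_w)`**:
`H_σ P^τ_w = dΓ_σ(A_w) P^τ_w` (`σ ≠ τ`). [cite: LangerMattis1971, eq. (5)] -/
theorem speciesHamiltonian_mul_configProj (t U : ℝ) {σ τ : Fin 2} (hστ : σ ≠ τ) (w : Finset Λ) :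
    speciesHamiltonian G t U σ * configProj τ w =
      dGammaSpin σ (lmOneBody G t U w) * configProj τ w := by
  simp only [speciesHamiltonian, dGammaSpin_lmOneBody, Matrix.add_mul, Matrix.smul_mul,
    interaction_mul_configProj hστ w]

/-! ### The one-body (Langer–Mattis) bound on Fock space -/

section OneBody

variable {κ : Type*} [Fintype κ]

/-- **Spectral expansion of `dΓ_σ`**: `Re ⟨φ, dΓ_σ(A) φ⟩ = Σ_k ε_k ‖c(v_k ⊗ e_σ) φ‖²` along a complete
family of eigenmodes `A v_k = ε_k v_k`. [folklore] -/
theorem re_rayleigh_dGammaSpin_eq_sum (σ : Fin 2) (A : Matrix Λ Λ ℂ) (v : κ → Λ → ℂ) (e : κ → ℝ)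
    (hv : ∀ x y : Λ, ∑ k, v k x * star (v k y) = if x = y then 1 else 0)
    (heig : ∀ k, A *ᵥ v k = ((e k : ℝ) : ℂ) • v k)
    (w : κ × Fin 2 → Orb Λ → ℂ)
    (hw : ∀ p o, w p o = if (ofLex o).2 = p.2 then v p.1 (ofLex o).1 else 0)
    (φ : Fock (Orb Λ)) :
    (star φ ⬝ᵥ (dGammaSpin σ A *ᵥ φ)).re = ∑ k, e k * normSq (annihilate (w (k, σ)) *ᵥ φ) := by
  have h1 : ∀ k, numberMode (w (k, σ)) =
      ∑ x, ∑ y, (v k x * star (v k y)) • (creation (orb x σ) * annihilation (orb y σ)) := fun k => by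
    rw [numberMode, create_spinMode_eq_sum v w hw, annihilate_spinMode_eq_sum v w hw, Finset.sum_mul_sum]
    simp only [smul_mul_smul_comm]
  have h2 : dGammaSpin σ A = ∑ k, (e k : ℂ) • numberMode (w (k, σ)) := by
    simp_rw [h1, Finset.smul_sum, smul_smul]
    rw [dGammaSpin]
    symm
    calc ∑ k, ∑ x, ∑ y, ((e k : ℂ) * (v k x * star (v k y))) • (creation (orb x σ) * annihilation (orb y σ))
        = ∑ x, ∑ k, ∑ y, ((e k : ℂ) * (v k x * star (v k y))) •
            (creation (orb x σ) * annihilation (orb y σ)) := Finset.sum_comm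
      _ = ∑ x, ∑ y, ∑ k, ((e k : ℂ) * (v k x * star (v k y))) •
            (creation (orb x σ) * annihilation (orb y σ)) :=
          Finset.sum_congr rfl fun x _ => Finset.sum_comm
      _ = ∑ x, ∑ y, A x y • (creation (orb x σ) * annihilation (orb y σ)) := by
          refine Finset.sum_congr rfl fun x _ => Finset.sum_congr rfl fun y _ => ?_
          rw [← Finset.sum_smul, apply_eq_sum_eigenmodes A v e hv heig x y]
  rw [h2, Matrix.sum_mulVec, dotProduct_sum, Complex.re_sum]
  refine Finset.sum_congr rfl fun k _ => ?_
  rw [Matrix.smul_mulVec, dotProduct_smul, star_dotProduct_numberMode_mulVec, smul_eq_mul,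
    ← Complex.ofReal_mul, Complex.ofReal_re]

/-- **The Langer–Mattis one-body bound on Fock space.** For a Hermitian site matrix `A` and every
Fock vector `φ`: `Re ⟨φ, dΓ_σ(A) φ⟩ ≥ (Σ_i min(λ_i(A), 0)) ‖φ‖²` — the energy of `dΓ_σ(A)` in any
state is at least the sum of the negative eigenvalues of `A` (each rotated occupation lies in
`[0, ‖φ‖²]`). [cite: LiebLoss1993, §8, proof of Theorem 8.2] -/
theorem sum_min_eigenvalues_mul_normSq_le (σ : Fin 2) {A : Matrix Λ Λ ℂ} (hA : A.IsHermitian)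
    (φ : Fock (Orb Λ)) :
    (∑ i, min (hA.eigenvalues i) 0) * normSq φ ≤ (star φ ⬝ᵥ (dGammaSpin σ A *ᵥ φ)).re := by
  classical
  set V : Matrix Λ Λ ℂ := (hA.eigenvectorUnitary : Matrix Λ Λ ℂ) with hVdef
  have hVV : V * star V = 1 := Matrix.mem_unitaryGroup_iff.1 hA.eigenvectorUnitary.2
  have hVV' : star V * V = 1 := Matrix.mem_unitaryGroup_iff'.1 hA.eigenvectorUnitary.2
  set v : Λ → Λ → ℂ := fun k x => V x k with hvdef
  have hv : ∀ x y : Λ, ∑ k, v k x * star (v k y) = if x = y then 1 else 0 := fun x y => by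
    have h := congrFun (congrFun hVV x) y
    simp only [Matrix.mul_apply, Matrix.star_apply, Matrix.one_apply] at h
    exact h
  have hon : ∀ k l, star (v k) ⬝ᵥ v l = if k = l then 1 else 0 := fun k l => by
    have h := congrFun (congrFun hVV' k) l
    simp only [Matrix.mul_apply, Matrix.star_apply, Matrix.one_apply] at h
    rw [dotProduct]
    simpa only [Pi.star_apply] using h
  have heig : ∀ k, A *ᵥ v k = ((hA.eigenvalues k : ℝ) : ℂ) • v k := fun k => by
    have hcol : v k = ⇑(hA.eigenvectorBasis k) := by
      funext x
      show V x k = _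
      rw [hVdef, Matrix.IsHermitian.eigenvectorUnitary_apply]
    rw [hcol, hA.mulVec_eigenvectorBasis k]
    funext x
    simp only [Pi.smul_apply, Complex.real_smul, smul_eq_mul]
  set w : Λ × Fin 2 → Orb Λ → ℂ := fun p o => if (ofLex o).2 = p.2 then v p.1 (ofLex o).1 else 0
    with hwdef
  have hw : ∀ p o, w p o = if (ofLex o).2 = p.2 then v p.1 (ofLex o).1 else 0 := fun p o => rfl
  rw [re_rayleigh_dGammaSpin_eq_sum σ A v hA.eigenvalues hv heig w hw φ, Finset.sum_mul]
  refine Finset.sum_le_sum fun k _ => ?_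
  have h0 : 0 ≤ normSq (annihilate (w (k, σ)) *ᵥ φ) := normSq_nonneg _
  have h1 : normSq (annihilate (w (k, σ)) *ᵥ φ) ≤ normSq φ :=
    normSq_annihilate_mulVec_le (spinMode_unit v hon w hw (k, σ)) φ
  rcases le_or_gt 0 (hA.eigenvalues k) with hk | hk
  · rw [min_eq_right hk, zero_mul]
    exact mul_nonneg hk h0
  · rw [min_eq_left hk.le]
    exact mul_le_mul_of_nonpos_left h1 hk.le

/-- `Σ_i min(λ_i, 0)` is the sum of the negative eigenvalues. [folklore] -/
theorem sum_min_eigenvalues_eq {A : Matrix Λ Λ ℂ} (hA : A.IsHermitian) :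
    ∑ i, min (hA.eigenvalues i) 0 =
      ∑ i ∈ Finset.univ.filter (fun i => hA.eigenvalues i < 0), hA.eigenvalues i := by
  rw [Finset.sum_filter]
  refine Finset.sum_congr rfl fun i _ => ?_
  by_cases h : hA.eigenvalues i < 0
  · rw [if_pos h, min_eq_left h.le]
  · rw [if_neg h, min_eq_right (not_lt.1 h)]

end OneBody

/-! ### Assembly -/

/-- The Langer–Mattis constant `Σ_i √(λ_i(tA_G)² + U²/16)` (`= Tr √(K² + U²/16)`; on the
`L × L` torus `Σ_k √(ε_k² + U²/16)` with `ε_k = 2t(cos k₁ + cos k₂)`).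
[cite: LangerMattis1971, eq. (3)] -/
def langerMattisSum (t U : ℝ) : ℝ :=
  ∑ i, Real.sqrt ((isHermitian_hopMatrix G t).eigenvalues i ^ 2 + (U / 4) ^ 2)

/-- **Kennedy–Lieb input**: for bipartite `G` and every frozen configuration `w`, the sum of the
negative eigenvalues of `h(s_w) = -tA_G + (U/4) diag(s_w)` is at least
`½((U/4)(2|w| - |Λ|) - Σ_i √(λ_i² + U²/16))` — the chessboard value.
[cite: KennedyLieb1986, Theorem 2.1][cite: LiebLoss1993, §8, Lemma 8.1 and Theorem 8.2] -/
theorem sum_min_eigenvalues_fkOneBody_ge (p : Λ → Bool) (hbip : ∀ x y, G.Adj x y → p x ≠ p y)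
    (t U : ℝ) (w : Finset Λ) :
    ((U / 4) * (2 * (w.card : ℝ) - Fintype.card Λ) - langerMattisSum G t U) / 2 ≤
      ∑ i, min ((FalicovKimball.isHermitian_fkOneBody (hopMatrix G t) (U / 4) (pmSign w)
        (isHermitian_hopMatrix G t)).eigenvalues i) 0 := by
  rw [sum_min_eigenvalues_eq, ← sum_pmSign w]
  exact FalicovKimball.kennedyLieb_sum_eigenvalues_ge (isHermitian_hopMatrix G t) p
    (hopMatrix_bipartite G t p hbip) (U / 4) (abs_pmSign_le w) _

/-- `N_τ P^τ_w ψ = |w| · P^τ_w ψ`: on the range of `P^τ_w` the number of `τ`-electrons is `|w|`.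
[folklore] -/
theorem sum_numberOp_mulVec_configProj_mulVec (τ : Fin 2) (w : Finset Λ) (ψ : Fock (Orb Λ)) :
    (∑ x : Λ, numberOp x τ) *ᵥ (configProj τ w *ᵥ ψ) = (w.card : ℂ) • (configProj τ w *ᵥ ψ) := by
  funext s
  rw [sum_numberOp_mulVec_apply, Pi.smul_apply, configProj, mulVec_diagonal, smul_eq_mul]
  by_cases hs : occ τ s = w
  · rw [if_pos hs, ← hs]
    rfl
  · rw [if_neg hs, zero_mul, mul_zero, mul_zero]

/-- `Σ_w |w| ‖P^τ_w ψ‖² = Re ⟨ψ, N_τ ψ⟩`. [folklore] -/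
theorem sum_card_mul_normSq_configProj_mulVec (τ : Fin 2) (ψ : Fock (Orb Λ)) :
    ∑ w : Finset Λ, (w.card : ℝ) * normSq (configProj τ w *ᵥ ψ) =
      (star ψ ⬝ᵥ ((∑ x : Λ, numberOp x τ) *ᵥ ψ)).re := by
  have hcomm : ∀ w, Commute (∑ x : Λ, numberOp x τ : Matrix (Finset (Orb Λ)) (Finset (Orb Λ)) ℂ)
      (configProj τ w) := fun w => by
    refine Commute.sum_left _ _ _ fun x _ => ?_
    rw [LiebThm1.numberOp_eq_diagonal]
    exact commute_configProj_diagonal τ _ w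
  rw [rayleigh_eq_sum_configProj τ hcomm ψ, Complex.re_sum]
  refine Finset.sum_congr rfl fun w _ => ?_
  rw [sum_numberOp_mulVec_configProj_mulVec, dotProduct_smul, star_dotProduct_self_eq_normSq, smul_eq_mul,
    ← Complex.ofReal_natCast, ← Complex.ofReal_mul, Complex.ofReal_re]

/-- `Σ_w Re ⟨P^τ_w ψ, N_σ P^τ_w ψ⟩ = Re ⟨ψ, N_σ ψ⟩`. [folklore] -/
theorem sum_re_rayleigh_numberOp_configProj_mulVec (σ τ : Fin 2) (ψ : Fock (Orb Λ)) :
    ∑ w : Finset Λ, (star (configProj τ w *ᵥ ψ) ⬝ᵥ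
        ((∑ x : Λ, numberOp x σ) *ᵥ (configProj τ w *ᵥ ψ))).re =
      (star ψ ⬝ᵥ ((∑ x : Λ, numberOp x σ) *ᵥ ψ)).re := by
  have hcomm : ∀ w, Commute (∑ x : Λ, numberOp x σ : Matrix (Finset (Orb Λ)) (Finset (Orb Λ)) ℂ)
      (configProj τ w) := fun w => by
    refine Commute.sum_left _ _ _ fun x _ => ?_
    rw [LiebThm1.numberOp_eq_diagonal]
    exact commute_configProj_diagonal τ _ w
  rw [rayleigh_eq_sum_configProj τ hcomm ψ, Complex.re_sum]

/-- **The species inequality** (Langer–Mattis + Kennedy–Lieb): for bipartite `G`, `σ ≠ τ` and every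
Fock vector `ψ`,
`Re ⟨ψ, H_σ ψ⟩ ≥ (U/4)(Re⟨ψ, N_σ ψ⟩ + Re⟨ψ, N_τ ψ⟩) - ½((U/4)|Λ| + Σ_i √(λ_i² + U²/16)) ‖ψ‖²`.
[cite: LangerMattis1971, eq. (5)][cite: KennedyLieb1986, Theorem 2.1] -/
theorem re_rayleigh_speciesHamiltonian_ge (p : Λ → Bool) (hbip : ∀ x y, G.Adj x y → p x ≠ p y)
    (t U : ℝ) {σ τ : Fin 2} (hστ : σ ≠ τ) (ψ : Fock (Orb Λ)) :
    (U / 4) * (star ψ ⬝ᵥ ((∑ x : Λ, numberOp x σ) *ᵥ ψ)).re +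
        (U / 4) * (star ψ ⬝ᵥ ((∑ x : Λ, numberOp x τ) *ᵥ ψ)).re -
        ((U / 4) * Fintype.card Λ + langerMattisSum G t U) / 2 * normSq ψ ≤
      (star ψ ⬝ᵥ (speciesHamiltonian G t U σ *ᵥ ψ)).re := by
  classical
  -- block decomposition along the frozen configurations of species `τ`
  rw [rayleigh_eq_sum_configProj τ (commute_speciesHamiltonian_configProj G t U hστ) ψ, Complex.re_sum,
    ← sum_re_rayleigh_numberOp_configProj_mulVec σ τ ψ, ← sum_card_mul_normSq_configProj_mulVec τ ψ,
    ← sum_normSq_configProj_mulVec τ ψ, Finset.mul_sum, Finset.mul_sum, Finset.mul_sum,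
    ← Finset.sum_add_distrib, ← Finset.sum_sub_distrib]
  refine Finset.sum_le_sum fun w _ => ?_
  set φ := configProj τ w *ᵥ ψ with hφ
  -- on the block, `H_σ` acts as `dΓ_σ(A_w) = dΓ_σ(h(s_w)) + (U/4) N_σ`
  have hact : speciesHamiltonian G t U σ *ᵥ φ = dGammaSpin σ (lmOneBody G t U w) *ᵥ φ := by
    rw [hφ, mulVec_mulVec, mulVec_mulVec, speciesHamiltonian_mul_configProj G t U hστ w]
  have hsplit : dGammaSpin σ (lmOneBody G t U w) =
      dGammaSpin σ (FalicovKimball.fkOneBody (hopMatrix G t) (U / 4) (pmSign w)) +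
        ((U / 4 : ℝ) : ℂ) • ∑ x : Λ, numberOp x σ := by
    rw [lmOneBody_eq_fkOneBody, dGammaSpin_add, dGammaSpin_smul, dGammaSpin_one]
  have hfk := sum_min_eigenvalues_mul_normSq_le σ
    (FalicovKimball.isHermitian_fkOneBody (hopMatrix G t) (U / 4) (pmSign w) (isHermitian_hopMatrix G t)) φ
  have hKL := sum_min_eigenvalues_fkOneBody_ge G p hbip t U w
  have hnn : 0 ≤ normSq φ := normSq_nonneg φ
  rw [hact, hsplit, add_mulVec, dotProduct_add, Complex.add_re, Matrix.smul_mulVec, dotProduct_smul,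
    smul_eq_mul, Complex.re_ofReal_mul]
  nlinarith [mul_le_mul_of_nonneg_right hKL hnn]

/-- `N = N_↑ + N_↓`. [folklore] -/
theorem totalNumber_eq_add :
    (totalNumber : Matrix (Finset (Orb Λ)) (Finset (Orb Λ)) ℂ) =
      (∑ x : Λ, numberOp x 0) + ∑ x : Λ, numberOp x 1 := by
  rw [totalNumber, ← Finset.sum_add_distrib]
  refine Finset.sum_congr rfl fun x _ => ?_
  rw [Fin.sum_univ_two]

/-- **The Langer–Mattis–Kennedy–Lieb operator inequality**: on a bipartite graph, for every Fock
vector `ψ`,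
`Re ⟨ψ, H ψ⟩ ≥ (U/2) Re ⟨ψ, N ψ⟩ - ((U/4)|Λ| + Σ_i √(λ_i(tA_G)² + U²/16)) ‖ψ‖²`.
[cite: LangerMattis1971, eqs. (4)–(5)][cite: KennedyLieb1986, Theorem 2.1] -/
theorem re_rayleigh_hamiltonian_ge (p : Λ → Bool) (hbip : ∀ x y, G.Adj x y → p x ≠ p y)
    (t U : ℝ) (ψ : Fock (Orb Λ)) :
    (U / 2) * (star ψ ⬝ᵥ (totalNumber *ᵥ ψ)).re -
        ((U / 4) * Fintype.card Λ + langerMattisSum G t U) * normSq ψ ≤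
      (star ψ ⬝ᵥ (hamiltonian G t U *ᵥ ψ)).re := by
  have h0 := re_rayleigh_speciesHamiltonian_ge G p hbip t U (σ := 0) (τ := 1) (by decide) ψ
  have h1 := re_rayleigh_speciesHamiltonian_ge G p hbip t U (σ := 1) (τ := 0) (by decide) ψ
  rw [hamiltonian_eq_add_speciesHamiltonian, add_mulVec, dotProduct_add, Complex.add_re]
  rw [totalNumber_eq_add, add_mulVec, dotProduct_add, Complex.add_re]
  linarith

/-- On the `N`-particle sector `N ψ = N · ψ`. [folklore] -/
theorem totalNumber_mulVec_of_isNParticle {N : ℕ} {ψ : Fock (Orb Λ)} (hψ : IsNParticle N ψ) :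
    totalNumber *ᵥ ψ = (N : ℂ) • ψ := by
  rw [← totalNumberOp_eq_totalNumber, totalNumberOp_eq_diagonal]
  funext s
  rw [mulVec_diagonal, Pi.smul_apply, smul_eq_mul]
  by_cases hs : s.card = N
  · rw [hs]
  · rw [hψ s hs, mul_zero, mul_zero]

/-- **Langer–Mattis–Kennedy–Lieb lower bound for the Hubbard ground-state energy.** On a finite
bipartite graph `G` (two-colouring `p`), for all real `t`, `U` and every `N ≤ 2|Λ|`:

  `groundEnergyAt G t U N ≥ (U/2) N - (U/4)|Λ| - Σ_i √(λ_i(t A_G)² + U²/16)`.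

Langer–Mattis, Phys. Lett. 36A (1971) 139, eqs. (4)–(5) (`E₀ ≥ E₁ + E₂`, species split with the
other spin immobilised), with the minimisation over the immobile configuration supplied by
Kennedy–Lieb, Physica A 138 (1986) 320, Theorem 2.1 (chessboard) — cf. Lieb–Loss, Duke Math. J. 71
(1993) §8, Theorem 8.2. [cite: LangerMattis1971, eqs. (4)–(5)][cite: KennedyLieb1986, Theorem 2.1] -/
theorem groundEnergyAt_ge (p : Λ → Bool) (hbip : ∀ x y, G.Adj x y → p x ≠ p y) (t U : ℝ)
    {N : ℕ} (hN : N ≤ 2 * Fintype.card Λ) :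
    (U / 2) * N - ((U / 4) * Fintype.card Λ + langerMattisSum G t U) ≤ groundEnergyAt G t U N := by
  obtain ⟨ψ, hψN, hψ1, hHψ⟩ := ThermodynamicLimit.exists_unit_groundState G t U hN
  have hnorm : normSq ψ = 1 := by
    have h := star_dotProduct_self_eq_normSq ψ
    rw [hψ1] at h
    exact_mod_cast h.symm
  have hE : (star ψ ⬝ᵥ (hamiltonian G t U *ᵥ ψ)).re = groundEnergyAt G t U N := by
    rw [hHψ, dotProduct_smul, hψ1, smul_eq_mul, mul_one, Complex.ofReal_re]
  have hNum : (star ψ ⬝ᵥ (totalNumber *ᵥ ψ)).re = N := by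
    rw [totalNumber_mulVec_of_isNParticle hψN, dotProduct_smul, hψ1, smul_eq_mul, mul_one,
      Complex.natCast_re]
  have h := re_rayleigh_hamiltonian_ge G p hbip t U ψ
  rw [hE, hNum, hnorm, mul_one] at h
  exact h

/-- **Half filling** (`N = |Λ|`): `E_G(|Λ|) ≥ (U/4)|Λ| - Σ_i √(λ_i(tA_G)² + U²/16)`, i.e. per site
Langer–Mattis' `E₀ ≥ E_A(U/2, 1)` [LangerMattis1971, eq. (3) and the line after eq. (5)].
[cite: LangerMattis1971, eqs. (3)–(5)][cite: KennedyLieb1986, Theorem 2.1] -/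
theorem groundEnergyAt_halfFilling_ge (p : Λ → Bool) (hbip : ∀ x y, G.Adj x y → p x ≠ p y)
    (t U : ℝ) :
    (U / 4) * Fintype.card Λ - langerMattisSum G t U ≤ groundEnergyAt G t U (Fintype.card Λ) := by
  have h := groundEnergyAt_ge G p hbip t U (N := Fintype.card Λ) (by omega)
  linarith

end LangerMattis

end Literature.MathematicalPhysics.QuantumLattice
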